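import Summits.QuantumFields.YangMills.Theorems.BalabanUVNodesN19RekeyingCalculus
import Summits.QuantumFields.YangMills.Theorems.BalabanUVNodesSpineReadingOfRecord13CoPHV
import Summits.QuantumFields.YangMills.Theorems.BalabanUVNodesN20KeyedRelWeightCutZero

/-!
# BalabanUVNodes ∕ node N19 (NE7) — THE CUT TRANSFER AT THE SPINE READING OF RECORD: every witness of node U5's four K5 faces at dag-n20-d's reading
# `crOfRecord₁₃VAt K₀ jcut sh` (ANY large-field cut `jcut`, ANY shell split `sh`) FOLDS to a witness at the ZERO cut `crOfRecord₁₃VAt K₀ (fun _ ↦ 0) sh♯`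
# with the FOLDED shell split `sh♯` («the whole class weight on the `jcut`-bad keys, `sh` off them») — `W ↦ 0`, `Wsh ↦ W + Wsh`, same `δ`, node U5's exit unchanged

Cell `pub-ymgap` (HUMAN RULING D-0062 Track A ∕ D-0149 width seats), WIDTH SEAT `pub-ymgap-dag-n19-w1` (node n19 = NE7, seat 1 of 3), generation g2, INTENT-2; the
record-level APPLICATION of this seat's INTENT-1 `…N19RekeyingCalculus` (§5 `shellWeightBound_foldBad` · `core_foldBad` · `hybridNE7_foldBad`).  Route
`Summits/QuantumFields/YangMills/Theses/BalabanUVNodes.lean`, key item K3⁷ `SpineGivenEndpointR13SepCoPH` (stmt-QuantumFields-20544); filed `--kind proof --supports … --as helper`.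
COUNT-NEUTRAL.  THEOREMS ONLY (0 `def`, 0 `sorry`).  ADDITIVE — imports this seat's `…N19RekeyingCalculus` (p593255), dag-n20-d's `…SpineReadingOfRecord13CoPHV` (p590105:
`crOfRecord₁₃VAt`, `relWeightBound_crOfRecord₁₃VAt`, `shellWeightBound_crOfRecord₁₃VAt`, `core_crOfRecord₁₃VAt`, `lt_one_crOfRecord₁₃VAt`; through it p587226's `classSet₁₃`,
`weightA₁₃`, `weightB₁₃`, `badClass₁₃`, `badClass₁₃_subset`, `ShellSplit₁₃CoPH`) and dag-n20-w2's `…N20KeyedRelWeightCutZero` (p590852: `badClass₁₃_cutZero`,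
`relWeightBound_carriers₁₃_cutZero`) — all CITED BY NAME; nothing re-declared, nothing modified.

WHY.  The registered K3⁷ stub 2 (`stub_expansion13H`; skeleton v3 02f6f498332fdbee, plan g81 — v2 145a664ea9c38a7b had a tuple-blind `jcut`) asks, per guarded reading,
for SOME cut reading `jc : CutReading` (per tuple), SOME shell split `sh` and the reading `cr = crOfRecord₁₃V (jc …) sh` on the live line (`crOfRecord₁₃V = crOfRecord₁₃VAt 0`,
`rfl`) with the four K5 faces N20 (`KeyedRelWeight`), N21 (`KeyedShellWeight`), N27x, N19′ (`KeyedCoreEdgeHolderD4`); everything below is per tuple at `crOfRecord₁₃VAt K₀ jcut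
sh`, so it instantiates at `K₀ := 0`, `jcut := jc F θ hP g₀ os`.  dag-n20-w2
LOCATED (p590852; plan g80 WORDS-1a answer (a) «INTENDED — `jcut` is the prover's dial; the faces pull oppositely, dag-n20-w3's `core_badKeysSigma_of_policy_le` ∕
`relWeightBound_badKeysSigma_of_policy_le`») that at `jcut := 0` the N20 face is FREE.  This file adds the other half of that picture, as kernel bookkeeping: the dial is
not only free at one end, it is REDUNDANT — whatever cut a closing proof uses, its witnesses FOLD to the zero cut, the `jcut`-bad keys' whole class weights becoming shell
parts of a folded split `sh♯` (characterised by two displayed equations `hfold₁ ∕ hfold₂`, no `def`), N20's weight `W` re-booked into N21's `Wsh`, N19′'s core clause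
unchanged on the `jcut`-good keys and trivially `0 ≤ 0 ≤ 0` on the others, node U5's exit `hybridDelta vol δ (W + Wsh)` untouched (INTENT-1 `hybridDelta_foldBad`).
So, at the (2.18)-index reading of record, «N20's booked content at the policy the closing proof USES» (plan (a)) is a PRESENTATION of the same estimate that can always
be re-presented as N21 + N19′ content at policy `0` — a located input for the v3 word, decided by nobody here.  SCOPE OF THE FOLD (said honestly): it is available exactly as
long as the stub quantifies the shell split (`∃ sh`); a v3 that PINS the split to the shell split OF RECORD (n21-d's `shellSplitOfRecord₁₃At N K₀ ρA ρB`, dag-n20-w3 g2 module 7)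
excludes `sh♯` and restores N20's slot as separate content at the pinned cut — that pin, not the cut dial, is what makes NE7b a distinct obligation at this index.
* §1 AT THE CARRIERS OF RECORD (any `K₀`, `jcut`, `sh`, tuple, `g₀`, `os`; `sh♯` = ANY pair satisfying the fold equations): ★ `shellWeightBound_carriers₁₃_foldCut` (N20 with
  `W` + N21 with `Wsh` at cut `jcut` ⇒ N21 with `W + Wsh` at the folded split) · ★ `core_carriers₁₃_foldCut` (N19′'s `Core` at cut `jcut` ⇒ `Core` at cut `0` for the folded
  cores, same `c_K`, same `δ`; `badClass₁₃ … (fun _ ↦ 0) = ∅` is dag-n20-w2's `badClass₁₃_cutZero`) · `coreNonneg_carriers₁₃_foldCut` · ★★ `hybridNE7_carriers₁₃_foldCut`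
  (the whole binder list: `HybridNE7 1 vol classSet₁₃ weightA₁₃ weightB₁₃ (badClass₁₃ jcut) W sh.1 sh.2 Wsh δ → HybridNE7 … (badClass₁₃ 0) 0 sh♯.1 sh♯.2 (W + Wsh) δ`).
* §2 AT THE READING `crOfRecord₁₃VAt` (physical volume letter, canonical weights ∕ rate): ★★ `hybridNE7_crOfRecord₁₃VAt_cutZero_of_witnesses` (ANY witnesses `W, Wsh, δ` of
  the four faces at the carriers with cut `jcut` and split `sh` ⇒ `HybridNE7` AT THE READING `crOfRecord₁₃VAt K₀ (fun _ ↦ 0) sh♯` in its own canonical letters, by dag-n20-d's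
  four transfers) · ★ `hybridNE7_crOfRecord₁₃VAt_cutZero_of_hybridNE7` (in particular from the faces AT the reading with cut `jcut`, whose fields are witnesses).

HONEST FRAMING.  Finite-sum bookkeeping [folklore] BY NAME over the tree's shapes and dag-n20-d's reading; NO estimate; nothing of Bałaban's asserted or instantiated (no
`Provisos₁₃CoPH` tuple, no shell split, no `HybridNE7` witness is constructed — K0⁷ OPEN); it says what the registered stub lets a prover re-present, not what is true of
Bałaban's runs.  NE7 ∕ NE7b ∕ NE7c NOT PRINTED for d = 4 ∕ NOT proved; N19 ∕ N20 ∕ N21 NOT discharged; K3⁷ NOT claimed; counts UNMOVED (typed 28∕28 · discharged 5∕27).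
One finite four-torus programme at fixed ε — NOT ℝ⁴, NOT OS, NOT a mass gap, NOT the Clay problem (R4 closes the conditional finite-𝕋⁴ rung `BalabanLadder.UV` only).
-/

noncomputable section

namespace Summit.QuantumFields.YangMills.BalabanUVNodes.N19CutTransfer

open Finset
open Summit.QuantumFields.BalabanUV.T4Continuum.Spine.NE7 (Core)
open Literature.MathematicalPhysics.QuantumFieldTheory.Balaban1983to89
open Literature.MathematicalPhysics.QuantumFieldTheory.Balaban1983to89.T4Continuum
open Literature.MathematicalPhysics.QuantumFieldTheory.Balaban1983to89.Node00
open T4WeightBudget (RelWeightBound)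
open T4IndicatorShell (ShellWeightBound)
open T4MatchingAssembly (HybridNE7 hybridNE7_of_relWeightBound)
open YMDAG.UVSplit
open Summit.QuantumFields.YangMills.BalabanUVNodes.N19RekeyingCalculus (shellWeightBound_foldBad core_foldBad hybridNE7_foldBad)
open Summit.QuantumFields.YangMills.BalabanUVNodes.N20KeyedRelWeightCutZero (badClass₁₃_cutZero relWeightBound_carriers₁₃_cutZero)

variable {F : T4Family} {N : ℕ} [NeZero N]

/-! ## §1 At the carriers of record: the faces at cut `jcut` fold to the faces at cut `0` -/

section Carriers

variable (K₀ : ℕ) (jcut : ℕ → ℕ) (θ : Stage13HParams F N) (hP : θ.Provisos₁₃CoPH F N) (g₀ : ℕ → ℝ) (os : List (ULoop F))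
  {shA shB shA' shB' : ℕ → ℝ → (Σ K, SiteSeqKey F (K₀ + K)) → ℝ} {W Wsh δ : ℕ → ℝ} {vol : ℝ}

/-- The bad class of record at the zero cut, as a family: identically `∅` (dag-n20-w2's `badClass₁₃_cutZero`, `funext`-ed). [folklore] -/
theorem badClass₁₃_cutZero_fun : badClass₁₃ θ K₀ g₀ (fun _ => 0) = fun _ _ => ∅ :=
  funext fun K => funext fun t => badClass₁₃_cutZero F θ K₀ g₀ K t

/-- **★ N20 + N21 AT CUT `jcut` ⇒ N21 AT THE FOLDED SPLIT** [folklore]: a relative weight bound `W` for the `jcut`-bad keys and a shell bound `Wsh` for `(shA, shB)` give the shell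
bound `W + Wsh` for ANY pair `(shA', shB')` satisfying the FOLD EQUATIONS «whole class weight on the `jcut`-bad keys, old shell off them» (INTENT-1 `shellWeightBound_foldBad`). -/
theorem shellWeightBound_carriers₁₃_foldCut
    (hfold₁ : letI : DecidableEq (Σ K, SiteSeqKey F (K₀ + K)) := Classical.decEq _
      ∀ (K : ℕ) (t : ℝ) (x : Σ K, SiteSeqKey F (K₀ + K)),
        shA' K t x = if x ∈ badClass₁₃ θ K₀ g₀ jcut K t then weightA₁₃ θ hP K₀ g₀ os K t x else shA K t x)
    (hfold₂ : letI : DecidableEq (Σ K, SiteSeqKey F (K₀ + K)) := Classical.decEq _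
      ∀ (K : ℕ) (t : ℝ) (x : Σ K, SiteSeqKey F (K₀ + K)),
        shB' K t x = if x ∈ badClass₁₃ θ K₀ g₀ jcut K t then weightB₁₃ θ hP K₀ g₀ os K t x else shB K t x)
    (hW : RelWeightBound 1 (classSet₁₃ θ K₀ g₀) (weightA₁₃ θ hP K₀ g₀ os) (weightB₁₃ θ hP K₀ g₀ os) (badClass₁₃ θ K₀ g₀ jcut) W)
    (hSh : ShellWeightBound 1 (classSet₁₃ θ K₀ g₀) (weightA₁₃ θ hP K₀ g₀ os) (weightB₁₃ θ hP K₀ g₀ os) shA shB Wsh) :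
    ShellWeightBound 1 (classSet₁₃ θ K₀ g₀) (weightA₁₃ θ hP K₀ g₀ os) (weightB₁₃ θ hP K₀ g₀ os) shA' shB' fun K => W K + Wsh K := by
  letI : DecidableEq (Σ K, SiteSeqKey F (K₀ + K)) := Classical.decEq _
  have e₁ : shA' = fun K t x => if x ∈ badClass₁₃ θ K₀ g₀ jcut K t then weightA₁₃ θ hP K₀ g₀ os K t x else shA K t x :=
    funext fun K => funext fun t => funext fun x => hfold₁ K t x
  have e₂ : shB' = fun K t x => if x ∈ badClass₁₃ θ K₀ g₀ jcut K t then weightB₁₃ θ hP K₀ g₀ os K t x else shB K t x :=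
    funext fun K => funext fun t => funext fun x => hfold₂ K t x
  rw [e₁, e₂]
  exact shellWeightBound_foldBad hW hSh

/-- **★ N19′ AT CUT `jcut` ⇒ N19′ AT CUT `0` FOR THE FOLDED CORES** [folklore]: `Core` on the `jcut`-good keys for the cores `weightA₁₃ − shA`, `weightB₁₃ − shB` IS `Core` on ALL keys
(the bad class of record at cut `0` is empty, dag-n20-w2) for the folded cores — same constant `c_K`, same rate `δ`, any volume letter (INTENT-1 `core_foldBad`). -/
theorem core_carriers₁₃_foldCut
    (hfold₁ : letI : DecidableEq (Σ K, SiteSeqKey F (K₀ + K)) := Classical.decEq _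
      ∀ (K : ℕ) (t : ℝ) (x : Σ K, SiteSeqKey F (K₀ + K)),
        shA' K t x = if x ∈ badClass₁₃ θ K₀ g₀ jcut K t then weightA₁₃ θ hP K₀ g₀ os K t x else shA K t x)
    (hfold₂ : letI : DecidableEq (Σ K, SiteSeqKey F (K₀ + K)) := Classical.decEq _
      ∀ (K : ℕ) (t : ℝ) (x : Σ K, SiteSeqKey F (K₀ + K)),
        shB' K t x = if x ∈ badClass₁₃ θ K₀ g₀ jcut K t then weightB₁₃ θ hP K₀ g₀ os K t x else shB K t x)
    (h : letI : DecidableEq (Σ K, SiteSeqKey F (K₀ + K)) := Classical.decEq _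
      Core 1 vol (classSet₁₃ θ K₀ g₀) (badClass₁₃ θ K₀ g₀ jcut) (fun K t x => weightA₁₃ θ hP K₀ g₀ os K t x - shA K t x)
        (fun K t x => weightB₁₃ θ hP K₀ g₀ os K t x - shB K t x) δ) :
    letI : DecidableEq (Σ K, SiteSeqKey F (K₀ + K)) := Classical.decEq _
    Core 1 vol (classSet₁₃ θ K₀ g₀) (badClass₁₃ θ K₀ g₀ (fun _ => 0)) (fun K t x => weightA₁₃ θ hP K₀ g₀ os K t x - shA' K t x)
      (fun K t x => weightB₁₃ θ hP K₀ g₀ os K t x - shB' K t x) δ := by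
  letI : DecidableEq (Σ K, SiteSeqKey F (K₀ + K)) := Classical.decEq _
  have e₁ : shA' = fun K t x => if x ∈ badClass₁₃ θ K₀ g₀ jcut K t then weightA₁₃ θ hP K₀ g₀ os K t x else shA K t x :=
    funext fun K => funext fun t => funext fun x => hfold₁ K t x
  have e₂ : shB' = fun K t x => if x ∈ badClass₁₃ θ K₀ g₀ jcut K t then weightB₁₃ θ hP K₀ g₀ os K t x else shB K t x :=
    funext fun K => funext fun t => funext fun x => hfold₂ K t x
  rw [e₁, e₂, badClass₁₃_cutZero_fun]
  exact core_foldBad h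

/-- The folded cores are non-negative on EVERY key (zero on the `jcut`-bad keys, `weight − shell ≥ 0` off them by the shell face) — the `hP0` input of dag-n20-d's
`core_crOfRecord₁₃VAt` at cut `0`. [folklore] -/
theorem coreNonneg_carriers₁₃_foldCut
    (hfold₁ : letI : DecidableEq (Σ K, SiteSeqKey F (K₀ + K)) := Classical.decEq _
      ∀ (K : ℕ) (t : ℝ) (x : Σ K, SiteSeqKey F (K₀ + K)),
        shA' K t x = if x ∈ badClass₁₃ θ K₀ g₀ jcut K t then weightA₁₃ θ hP K₀ g₀ os K t x else shA K t x)
    (hSh : ShellWeightBound 1 (classSet₁₃ θ K₀ g₀) (weightA₁₃ θ hP K₀ g₀ os) (weightB₁₃ θ hP K₀ g₀ os) shA shB Wsh) :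
    letI : DecidableEq (Σ K, SiteSeqKey F (K₀ + K)) := Classical.decEq _
    ∀ (K : ℕ) (t : ℝ), |t| ≤ 1 → ∀ x ∈ classSet₁₃ θ K₀ g₀ K \ badClass₁₃ θ K₀ g₀ (fun _ => 0) K t,
      0 ≤ weightA₁₃ θ hP K₀ g₀ os K t x - shA' K t x := by
  letI : DecidableEq (Σ K, SiteSeqKey F (K₀ + K)) := Classical.decEq _
  intro K t ht x hx
  have hxT : x ∈ classSet₁₃ θ K₀ g₀ K := (Finset.mem_sdiff.mp hx).1
  rw [hfold₁ K t x]
  split_ifs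
  · simp
  · exact sub_nonneg.mpr (hSh.sh_le_left K t ht x hxT)

/-- **★★ THE WHOLE BINDER LIST AT THE CARRIERS: CUT `jcut` ⇒ CUT `0`** [folklore]: `HybridNE7` at the carriers of record with bad class `badClass₁₃ … jcut`, weights `W`, split
`(shA, shB)`, shell weight `Wsh`, rate `δ` ⇒ `HybridNE7` at the same carriers with bad class `badClass₁₃ … (fun _ ↦ 0)` (`= ∅`), weight `0`, the folded split, shell weight
`W + Wsh`, the SAME `δ` (INTENT-1 `hybridNE7_foldBad`; the N20 face at cut `0` is dag-n20-w2's `relWeightBound_carriers₁₃_cutZero`). -/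
theorem hybridNE7_carriers₁₃_foldCut
    (hfold₁ : letI : DecidableEq (Σ K, SiteSeqKey F (K₀ + K)) := Classical.decEq _
      ∀ (K : ℕ) (t : ℝ) (x : Σ K, SiteSeqKey F (K₀ + K)),
        shA' K t x = if x ∈ badClass₁₃ θ K₀ g₀ jcut K t then weightA₁₃ θ hP K₀ g₀ os K t x else shA K t x)
    (hfold₂ : letI : DecidableEq (Σ K, SiteSeqKey F (K₀ + K)) := Classical.decEq _
      ∀ (K : ℕ) (t : ℝ) (x : Σ K, SiteSeqKey F (K₀ + K)),
        shB' K t x = if x ∈ badClass₁₃ θ K₀ g₀ jcut K t then weightB₁₃ θ hP K₀ g₀ os K t x else shB K t x)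
    (h : letI : DecidableEq (Σ K, SiteSeqKey F (K₀ + K)) := Classical.decEq _
      HybridNE7 1 vol (classSet₁₃ θ K₀ g₀) (weightA₁₃ θ hP K₀ g₀ os) (weightB₁₃ θ hP K₀ g₀ os) (badClass₁₃ θ K₀ g₀ jcut) W shA shB Wsh δ) :
    letI : DecidableEq (Σ K, SiteSeqKey F (K₀ + K)) := Classical.decEq _
    HybridNE7 1 vol (classSet₁₃ θ K₀ g₀) (weightA₁₃ θ hP K₀ g₀ os) (weightB₁₃ θ hP K₀ g₀ os) (badClass₁₃ θ K₀ g₀ (fun _ => 0)) (fun _ => 0) shA' shB'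
      (fun K => W K + Wsh K) δ := by
  letI : DecidableEq (Σ K, SiteSeqKey F (K₀ + K)) := Classical.decEq _
  exact hybridNE7_of_relWeightBound (relWeightBound_carriers₁₃_cutZero F θ hP K₀ g₀ os)
    (shellWeightBound_carriers₁₃_foldCut K₀ jcut θ hP g₀ os hfold₁ hfold₂ h.weight h.shell) (fun K => by simpa only [zero_add] using h.lt_one K) h.summable
    (core_carriers₁₃_foldCut K₀ jcut θ hP g₀ os hfold₁ hfold₂ h.core)

end Carriers

/-! ## §2 At the reading `crOfRecord₁₃VAt`: witnesses at cut `jcut` give the faces AT the reading with cut `0` and the folded split -/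

section Reading

variable (K₀ : ℕ) (jcut : ℕ → ℕ) (sh sh' : ShellSplit₁₃CoPH N K₀) (θ : Stage13HParams F N) (hP : θ.Provisos₁₃CoPH F N) (g₀ : ℕ → ℝ) (os : List (ULoop F))
  {W Wsh δ : ℕ → ℝ}

/-- **★★ CUT TRANSFER AT THE READING OF RECORD** [folklore].  ANY witnesses at the carriers of the tuple with cut `jcut` and split `sh` — N20 `RelWeightBound … (badClass₁₃ … jcut) W`,
N21 `ShellWeightBound … (sh …).1 (sh …).2 Wsh`, U4′ `W + Wsh < 1`, N19′ `Core 1 (F.side ^ 4) … (badClass₁₃ … jcut) (weightA₁₃ − sh.1) (weightB₁₃ − sh.2) δ` with `Summable δ` — give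
node U5's HYBRID BINDER LIST `HybridNE7` AT THE READING `crOfRecord₁₃VAt K₀ (fun _ ↦ 0) sh'` in that reading's OWN canonical letters (`W = wInf`, `Wsh = wshInf`, `δ = deltaCan`),
for ANY split `sh'` folding `sh` at this tuple (`hfold₁ ∕ hfold₂`): dag-n20-d's four transfers applied to §1. -/
theorem hybridNE7_crOfRecord₁₃VAt_cutZero_of_witnesses
    (hfold₁ : letI : DecidableEq (Σ K, SiteSeqKey F (K₀ + K)) := Classical.decEq _
      ∀ (K : ℕ) (t : ℝ) (x : Σ K, SiteSeqKey F (K₀ + K)),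
        (sh' F θ hP g₀ os).1 K t x = if x ∈ badClass₁₃ θ K₀ g₀ jcut K t then weightA₁₃ θ hP K₀ g₀ os K t x else (sh F θ hP g₀ os).1 K t x)
    (hfold₂ : letI : DecidableEq (Σ K, SiteSeqKey F (K₀ + K)) := Classical.decEq _
      ∀ (K : ℕ) (t : ℝ) (x : Σ K, SiteSeqKey F (K₀ + K)),
        (sh' F θ hP g₀ os).2 K t x = if x ∈ badClass₁₃ θ K₀ g₀ jcut K t then weightB₁₃ θ hP K₀ g₀ os K t x else (sh F θ hP g₀ os).2 K t x)
    (hW : RelWeightBound 1 (classSet₁₃ θ K₀ g₀) (weightA₁₃ θ hP K₀ g₀ os) (weightB₁₃ θ hP K₀ g₀ os) (badClass₁₃ θ K₀ g₀ jcut) W)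
    (hSh : ShellWeightBound 1 (classSet₁₃ θ K₀ g₀) (weightA₁₃ θ hP K₀ g₀ os) (weightB₁₃ θ hP K₀ g₀ os) (sh F θ hP g₀ os).1 (sh F θ hP g₀ os).2 Wsh)
    (hlt : ∀ K, W K + Wsh K < 1)
    (hcore : letI : DecidableEq (Σ K, SiteSeqKey F (K₀ + K)) := Classical.decEq _
      Core 1 (F.side ^ 4) (classSet₁₃ θ K₀ g₀) (badClass₁₃ θ K₀ g₀ jcut) (fun K t x => weightA₁₃ θ hP K₀ g₀ os K t x - (sh F θ hP g₀ os).1 K t x)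
        (fun K t x => weightB₁₃ θ hP K₀ g₀ os K t x - (sh F θ hP g₀ os).2 K t x) δ)
    (hδ : Summable δ) :
    letI := (crOfRecord₁₃VAt K₀ (fun _ => 0) sh' F θ hP g₀ os).dec
    HybridNE7 (crOfRecord₁₃VAt K₀ (fun _ => 0) sh' F θ hP g₀ os).l₀ (crOfRecord₁₃VAt K₀ (fun _ => 0) sh' F θ hP g₀ os).vol
      (crOfRecord₁₃VAt K₀ (fun _ => 0) sh' F θ hP g₀ os).T (crOfRecord₁₃VAt K₀ (fun _ => 0) sh' F θ hP g₀ os).A (crOfRecord₁₃VAt K₀ (fun _ => 0) sh' F θ hP g₀ os).B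
      (crOfRecord₁₃VAt K₀ (fun _ => 0) sh' F θ hP g₀ os).Bad (crOfRecord₁₃VAt K₀ (fun _ => 0) sh' F θ hP g₀ os).W
      (crOfRecord₁₃VAt K₀ (fun _ => 0) sh' F θ hP g₀ os).shA (crOfRecord₁₃VAt K₀ (fun _ => 0) sh' F θ hP g₀ os).shB
      (crOfRecord₁₃VAt K₀ (fun _ => 0) sh' F θ hP g₀ os).Wsh (crOfRecord₁₃VAt K₀ (fun _ => 0) sh' F θ hP g₀ os).δ := by
  letI : DecidableEq (Σ K, SiteSeqKey F (K₀ + K)) := Classical.decEq _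
  letI := (crOfRecord₁₃VAt K₀ (fun _ => 0) sh' F θ hP g₀ os).dec
  have hSh' := shellWeightBound_carriers₁₃_foldCut K₀ jcut θ hP g₀ os hfold₁ hfold₂ hW hSh
  have hcore' := core_carriers₁₃_foldCut K₀ jcut θ hP g₀ os hfold₁ hfold₂ hcore
  have hP0 := coreNonneg_carriers₁₃_foldCut K₀ jcut θ hP g₀ os (shB := (sh F θ hP g₀ os).2) hfold₁ hSh
  have hW0 := relWeightBound_carriers₁₃_cutZero F θ hP K₀ g₀ os
  obtain ⟨hC, hS⟩ := core_crOfRecord₁₃VAt K₀ (fun _ => 0) sh' θ hP g₀ os hP0 hcore' hδ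
  exact hybridNE7_of_relWeightBound (relWeightBound_crOfRecord₁₃VAt K₀ (fun _ => 0) sh' θ hP g₀ os hW0)
    (shellWeightBound_crOfRecord₁₃VAt K₀ (fun _ => 0) sh' θ hP g₀ os hSh')
    (lt_one_crOfRecord₁₃VAt K₀ (fun _ => 0) sh' θ hP g₀ os hW0 hSh' fun K => by simpa only [zero_add] using hlt K) hS hC

/-- **★ IN PARTICULAR FROM THE FACES AT THE READING WITH CUT `jcut`** [folklore]: the hybrid binder list AT `crOfRecord₁₃VAt K₀ jcut sh` (its own fields as witnesses) folds to the
hybrid binder list AT `crOfRecord₁₃VAt K₀ (fun _ ↦ 0) sh'` — the `∃ jcut` of a K5 witness at the reading of record is, for the binder list as a whole, without loss of generality `0`. -/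
theorem hybridNE7_crOfRecord₁₃VAt_cutZero_of_hybridNE7
    (hfold₁ : letI : DecidableEq (Σ K, SiteSeqKey F (K₀ + K)) := Classical.decEq _
      ∀ (K : ℕ) (t : ℝ) (x : Σ K, SiteSeqKey F (K₀ + K)),
        (sh' F θ hP g₀ os).1 K t x = if x ∈ badClass₁₃ θ K₀ g₀ jcut K t then weightA₁₃ θ hP K₀ g₀ os K t x else (sh F θ hP g₀ os).1 K t x)
    (hfold₂ : letI : DecidableEq (Σ K, SiteSeqKey F (K₀ + K)) := Classical.decEq _
      ∀ (K : ℕ) (t : ℝ) (x : Σ K, SiteSeqKey F (K₀ + K)),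
        (sh' F θ hP g₀ os).2 K t x = if x ∈ badClass₁₃ θ K₀ g₀ jcut K t then weightB₁₃ θ hP K₀ g₀ os K t x else (sh F θ hP g₀ os).2 K t x)
    (h : letI := (crOfRecord₁₃VAt K₀ jcut sh F θ hP g₀ os).dec
      HybridNE7 (crOfRecord₁₃VAt K₀ jcut sh F θ hP g₀ os).l₀ (crOfRecord₁₃VAt K₀ jcut sh F θ hP g₀ os).vol
        (crOfRecord₁₃VAt K₀ jcut sh F θ hP g₀ os).T (crOfRecord₁₃VAt K₀ jcut sh F θ hP g₀ os).A (crOfRecord₁₃VAt K₀ jcut sh F θ hP g₀ os).B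
        (crOfRecord₁₃VAt K₀ jcut sh F θ hP g₀ os).Bad (crOfRecord₁₃VAt K₀ jcut sh F θ hP g₀ os).W
        (crOfRecord₁₃VAt K₀ jcut sh F θ hP g₀ os).shA (crOfRecord₁₃VAt K₀ jcut sh F θ hP g₀ os).shB
        (crOfRecord₁₃VAt K₀ jcut sh F θ hP g₀ os).Wsh (crOfRecord₁₃VAt K₀ jcut sh F θ hP g₀ os).δ) :
    letI := (crOfRecord₁₃VAt K₀ (fun _ => 0) sh' F θ hP g₀ os).dec
    HybridNE7 (crOfRecord₁₃VAt K₀ (fun _ => 0) sh' F θ hP g₀ os).l₀ (crOfRecord₁₃VAt K₀ (fun _ => 0) sh' F θ hP g₀ os).vol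
      (crOfRecord₁₃VAt K₀ (fun _ => 0) sh' F θ hP g₀ os).T (crOfRecord₁₃VAt K₀ (fun _ => 0) sh' F θ hP g₀ os).A (crOfRecord₁₃VAt K₀ (fun _ => 0) sh' F θ hP g₀ os).B
      (crOfRecord₁₃VAt K₀ (fun _ => 0) sh' F θ hP g₀ os).Bad (crOfRecord₁₃VAt K₀ (fun _ => 0) sh' F θ hP g₀ os).W
      (crOfRecord₁₃VAt K₀ (fun _ => 0) sh' F θ hP g₀ os).shA (crOfRecord₁₃VAt K₀ (fun _ => 0) sh' F θ hP g₀ os).shB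
      (crOfRecord₁₃VAt K₀ (fun _ => 0) sh' F θ hP g₀ os).Wsh (crOfRecord₁₃VAt K₀ (fun _ => 0) sh' F θ hP g₀ os).δ := by
  letI := (crOfRecord₁₃VAt K₀ jcut sh F θ hP g₀ os).dec
  exact hybridNE7_crOfRecord₁₃VAt_cutZero_of_witnesses K₀ jcut sh sh' θ hP g₀ os hfold₁ hfold₂ h.weight h.shell h.lt_one h.core h.summable

end Reading

end Summit.QuantumFields.YangMills.BalabanUVNodes.N19CutTransfer

end
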